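import Mathlib
import Summits.Ventures.LatticeQCDFlow.Scaling.SlabKernel
import Summits.Ventures.LatticeQCDFlow.Scaling.SlabChainLeading

/-!
# LatticeQCDFlow / Scaling — slab chains: the doubled slab factors, their expansion over subsets of
# slabs, the cut cancellation and the trichotomy of subsets — file 5 of the slab-chain proof of (LC)

HONEST FRAMING: exact (Metropolis-corrected) sampling algorithms for lattice gauge theory;
figures of merit are autocorrelation/cost numbers at stated couplings and volumes; no
continuum-physics claim.

Venture `LatticeQCDFlow` (cell pub-lqcd), topic `Scaling`, FANOUT row 30 (lean-1) — OUR WORK (LEAD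
LINE 230 (G3′)).  In the replica space `(η, η')` the product of the two kernel products is
`∏_h K_h(η_h,η_{h+1}) K_h(η'_h,η'_{h+1}) = ∏_h (cpoly_h(β)² + T_h)` with the DOUBLED SLAB FACTOR
`T_h = K_h K'_h − cpoly_h²` (`dT`), and `Finset.prod_add` expands it over the subsets `S` of slabs
(`kernelProd_mul_kernelProd_eq_sum`).  This file supplies, for the terms of that expansion:
* `dT_unifO` — `T_h = O(β^g)` uniformly; `dT_leading_unifO` — `T_h = β^g (ρ_h(η) + ρ_h(η')) +
  O(β^{g+1})` uniformly (from `kernel_unifO` of `Scaling/SlabKernel.lean`);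
* `dT_pswap` / **`integral_slabTerm_eq_zero_of_cut`** — if `S` misses a slab `h₁` below the
  height `τ` of the second observable and a slab `h₂` at or above it, the term of `S` VANISHES
  IDENTICALLY in `β`: the partial replica swap of the arc `{h ≤ h₁} ∪ {h > h₂}` (which contains
  `0` and not `τ`) reverses the sign of `(x(η_0) − x(η'_0))(y(η_τ) − y(η'_τ))` and fixes every other
  factor (`Scaling/SlabChainVanishing.integral_eq_zero_of_pswap_odd`);
* `cut_or_eq_or_card` — every other `S` is `[0, τ)` itself or has at least `τ + 1` slabs, provided
  `2τ ≤ n` (the long arc is longer than the short one).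
Elementary; nothing is cited as a fact; one `def` (`dT`); no `sorry`.
-/

noncomputable section

open MeasureTheory Filter Topology Asymptotics Finset
open scoped Nat
open Literature.MathematicalPhysics.QuantumFieldTheory (JetEq BddAt)
open Summit.Ventures.LatticeQCDFlow.Theory2.Tilted

namespace Summit.Ventures.LatticeQCDFlow.Theory2

/-- Transport of a `UnifO` estimate along a pointwise identity of families. [folklore] -/
theorem UnifO.congr' {α : Type*} {k : ℕ} {F G : ℂ → α → ℂ} (h : UnifO k F)
    (hFG : ∀ β a, F β a = G β a) : UnifO k G := by
  obtain ⟨C, r, hr, hb⟩ := h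
  exact ⟨C, r, hr, fun β hβ a => by rw [← hFG]; exact hb β hβ a⟩

namespace SlabChain

variable {n : ℕ} {E V : Type*} [MeasurableSpace E] [MeasurableSpace V]
  (μ : Measure E) (μV : Measure V) [IsProbabilityMeasure μ] [IsProbabilityMeasure μV]
  {D : SlabChain n E V} {Ma Ms : ℝ} {g : ℕ} {c : Fin (n + 1) → ℕ → ℂ}
  {ρ : Fin (n + 1) → E → E → ℂ} {Mρ : ℝ}

/-! ## 1. Uniform estimates for the kernel read on the replica space -/

/-- The kernel itself is a `UnifO 0` family (bounded near `β = 0`). [folklore] -/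
theorem kernel_unifO_zero (hD : D.Bounds Ma Ms) (h : Fin (n + 1)) :
    UnifO 0 (fun β (p : E × E) => D.kernel μV β h p.1 p.2) := by
  refine UnifO.of_norm_le_of_lt (C := Real.exp Ms) one_pos fun β hβ p => ?_
  refine (norm_kernel_le hD μV β h p.1 p.2).trans (Real.exp_le_exp.2 ?_)
  calc ‖β‖ * Ms ≤ 1 * Ms := mul_le_mul_of_nonneg_right hβ.le hD.Ms_nonneg
    _ = Ms := one_mul Ms

/-- `K_h(β; e, e') − cpoly_h(β) = O(β^g)` uniformly, when `ρ` is bounded. [folklore] -/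
theorem kernel_sub_cpoly_unifO (hD : D.Bounds Ma Ms) (hM : D.Moments μV g c ρ)
    (hρb : ∀ h e e', ‖ρ h e e'‖ ≤ Mρ) (h : Fin (n + 1)) :
    UnifO g (fun β (p : E × E) => D.kernel μV β h p.1 p.2 - cpoly c g h β) := by
  refine UnifO.of_leading (P := fun p : E × E => ρ h p.1 p.2) (fun p => hρb h p.1 p.2) ?_
  exact (kernel_unifO μV hD hM h).congr' fun β p => by ring

/-- A probability space is non-empty. [folklore] -/
theorem nonempty_of_prob {Ω : Type*} [MeasurableSpace Ω] (m : Measure Ω) [IsProbabilityMeasure m] :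
    Nonempty Ω := by
  by_contra hE
  rw [not_nonempty_iff] at hE
  have := IsProbabilityMeasure.measure_univ (μ := m)
  rw [Set.univ_eq_empty_iff.2 hE, measure_empty] at this
  exact zero_ne_one this

omit [MeasurableSpace E] in
/-- `cpoly_h(β)` is a `UnifO 0` family and `cpoly_h(β) − 1` a `UnifO 1` family (`g ≥ 1`). [folklore] -/
theorem cpoly_unifO [Nonempty E] (hM : D.Moments μV g c ρ) (hg : 1 ≤ g) (h : Fin (n + 1))
    {α : Type*} :
    UnifO 0 (fun (β : ℂ) (_ : α) => cpoly c g h β) ∧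
      UnifO 1 (fun (β : ℂ) (_ : α) => cpoly c g h β - 1) := by
  obtain ⟨e₀⟩ := ‹Nonempty E›
  refine ⟨UnifO.of_bddAt (bddAt_cpoly c g h), ?_⟩
  have h0 : cpoly c g h 0 = 1 := by rw [cpoly_zero, c_zero_eq_one μV hM hg h e₀ e₀]
  have hO := cpoly_sub_isBigO c g h
  rw [h0] at hO
  exact UnifO.of_isBigO hO

/-! ## 2. The doubled slab factor -/

/-- **The doubled slab factor** `T_h(β; η, η') = K_h(η_h, η_{h+1}) K_h(η'_h, η'_{h+1}) − cpoly_h(β)²`.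
[folklore] -/
def dT (D : SlabChain n E V) (μV : Measure V) (c : Fin (n + 1) → ℕ → ℂ) (g : ℕ) (β : ℂ)
    (h : Fin (n + 1)) (q : (Fin (n + 1) → E) × (Fin (n + 1) → E)) : ℂ :=
  D.kernel μV β h (q.1 h) (q.1 (h + 1)) * D.kernel μV β h (q.2 h) (q.2 (h + 1)) - cpoly c g h β ^ 2

omit [MeasurableSpace E] [IsProbabilityMeasure μV] in
/-- **Expansion over subsets of slabs**:
`∏_h K_h(η) · ∏_h K_h(η') = Σ_S (∏_{h∈S} T_h) · ∏_{h∉S} cpoly_h²`. [folklore] -/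
theorem kernelProd_mul_kernelProd_eq_sum (β : ℂ) (q : (Fin (n + 1) → E) × (Fin (n + 1) → E)) :
    D.kernelProd μV β q.1 * D.kernelProd μV β q.2 =
      ∑ S ∈ (univ : Finset (Fin (n + 1))).powerset,
        (∏ h ∈ S, dT D μV c g β h q) * ∏ h ∈ univ \ S, cpoly c g h β ^ 2 := by
  unfold kernelProd
  rw [← prod_mul_distrib, ← prod_add]
  refine prod_congr rfl fun h _ => ?_
  simp [dT]

/-- `T_h = O(β^g)` uniformly on the replica space. [folklore] -/
theorem dT_unifO [Nonempty E] (hD : D.Bounds Ma Ms) (hM : D.Moments μV g c ρ) (hg : 1 ≤ g)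
    (hρb : ∀ h e e', ‖ρ h e e'‖ ≤ Mρ) (h : Fin (n + 1)) :
    UnifO g (fun β q => dT D μV c g β h q) := by
  -- `T = (K − c) K' + c (K' − c)`
  have hK1 := (kernel_sub_cpoly_unifO μV hD hM hρb h).comp
    (fun q : (Fin (n + 1) → E) × (Fin (n + 1) → E) => (q.1 h, q.1 (h + 1)))
  have hK2 := (kernel_sub_cpoly_unifO μV hD hM hρb h).comp
    (fun q : (Fin (n + 1) → E) × (Fin (n + 1) → E) => (q.2 h, q.2 (h + 1)))
  have hK2' := (kernel_unifO_zero μV hD h).comp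
    (fun q : (Fin (n + 1) → E) × (Fin (n + 1) → E) => (q.2 h, q.2 (h + 1)))
  have hc := (cpoly_unifO μV hM hg h (α := (Fin (n + 1) → E) × (Fin (n + 1) → E))).1
  have hsum := ((hK1.mul hK2').mono (show g ≤ g + 0 by omega)).add
    ((hc.mul hK2).mono (show g ≤ 0 + g by omega))
  refine hsum.congr' fun β q => ?_
  simp only [dT]
  ring

/-- `T_h = β^g (ρ_h(η_h, η_{h+1}) + ρ_h(η'_h, η'_{h+1})) + O(β^{g+1})` uniformly. [folklore] -/
theorem dT_leading_unifO [Nonempty E] (hD : D.Bounds Ma Ms) (hM : D.Moments μV g c ρ) (hg : 1 ≤ g)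
    (hρb : ∀ h e e', ‖ρ h e e'‖ ≤ Mρ) (h : Fin (n + 1)) :
    UnifO (g + 1) (fun β q => dT D μV c g β h q -
      β ^ g * (ρ h (q.1 h) (q.1 (h + 1)) + ρ h (q.2 h) (q.2 (h + 1)))) := by
  set π₁ := fun q : (Fin (n + 1) → E) × (Fin (n + 1) → E) => (q.1 h, q.1 (h + 1)) with hπ₁
  set π₂ := fun q : (Fin (n + 1) → E) × (Fin (n + 1) → E) => (q.2 h, q.2 (h + 1)) with hπ₂
  have hA := (kernel_unifO μV hD hM h).comp π₁           -- K₁ − c − β^g ρ₁ : g+1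
  have hB := (kernel_unifO μV hD hM h).comp π₂           -- K₂ − c − β^g ρ₂ : g+1
  have hK2 := (kernel_unifO_zero μV hD h).comp π₂        -- K₂ : 0
  have hK2c := (kernel_sub_cpoly_unifO μV hD hM hρb h).comp π₂   -- K₂ − c : g
  obtain ⟨hc0, hc1⟩ := cpoly_unifO μV hM hg h (α := (Fin (n + 1) → E) × (Fin (n + 1) → E))
  have hρ1 : UnifO 0 (fun (_ : ℂ) (q : (Fin (n + 1) → E) × (Fin (n + 1) → E)) =>
      ρ h (q.1 h) (q.1 (h + 1))) := UnifO.of_norm_le fun _ q => hρb h _ _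
  have hρ2 : UnifO 0 (fun (_ : ℂ) (q : (Fin (n + 1) → E) × (Fin (n + 1) → E)) =>
      ρ h (q.2 h) (q.2 (h + 1))) := UnifO.of_norm_le fun _ q => hρb h _ _
  -- `K₂ − 1 = (K₂ − c) + (c − 1)` is `UnifO 1`
  have hK21 : UnifO 1 (fun β q => D.kernel μV β h (π₂ q).1 (π₂ q).2 - 1) :=
    ((hK2c.mono hg).add hc1).congr' fun β q => by ring
  -- the four pieces
  have t1 := hA.mul hK2                                   -- (g+1) + 0
  have t2 := hc0.mul hB                                   -- 0 + (g+1)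
  have t3 := (hρ1.pow_mul g).mul hK21                     -- (g+0) + 1
  have t4 := (hρ2.pow_mul g).mul hc1                      -- (g+0) + 1
  have hsum := ((t1.add (t2.mono (by omega))).add (t3.mono (by omega))).add (t4.mono (by omega))
  refine hsum.congr' fun β q => ?_
  simp only [dT, hπ₁, hπ₂]
  ring

/-! ## 3. The cut cancellation -/

section Cut

variable {x y : E → ℝ} {τ : Fin (n + 1)}

/-- The arc `{h ≤ h₁} ∪ {h > h₂}` of heights is closed under `h ↦ h + 1` away from its two cut
slabs `h₁ < h₂`. [folklore] -/
theorem mem_arc_iff_succ_mem {h₁ h₂ h : Fin (n + 1)} (hlt : h₁.val < h₂.val) (hh₁ : h ≠ h₁)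
    (hh₂ : h ≠ h₂) :
    (h.val ≤ h₁.val ∨ h₂.val < h.val) ↔ ((h + 1).val ≤ h₁.val ∨ h₂.val < (h + 1).val) := by
  have hv1 : h.val ≠ h₁.val := fun e => hh₁ (Fin.ext e)
  have hv2 : h.val ≠ h₂.val := fun e => hh₂ (Fin.ext e)
  have h2n : h₂.val ≤ n := Nat.lt_succ_iff.mp h₂.isLt
  rw [Fin.val_add_one]
  split_ifs with hl
  · rw [hl, Fin.val_last] at hv2 ⊢
    constructor
    · intro _; left; exact Nat.zero_le _
    · intro _; right; omega
  · have hlt' : h.val < n := by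
      have := Nat.lt_succ_iff.mp h.isLt
      exact lt_of_le_of_ne this fun e => hl (Fin.ext (by rw [e, Fin.val_last]))
    omega

omit [MeasurableSpace E] [IsProbabilityMeasure μV] in
/-- **The doubled slab factor is invariant under the partial swap of the arc**, for a slab that is
not one of the two cuts. [folklore] -/
theorem dT_pswap {h₁ h₂ : Fin (n + 1)} (hlt : h₁.val < h₂.val) {h : Fin (n + 1)} (hh₁ : h ≠ h₁)
    (hh₂ : h ≠ h₂) (β : ℂ) (q : (Fin (n + 1) → E) × (Fin (n + 1) → E)) :
    dT D μV c g β h (pswap (univ.filter fun k : Fin (n + 1) => k.val ≤ h₁.val ∨ h₂.val < k.val) q) =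
      dT D μV c g β h q := by
  set 𝒜 := univ.filter fun k : Fin (n + 1) => k.val ≤ h₁.val ∨ h₂.val < k.val with h𝒜
  have hiff := mem_arc_iff_succ_mem hlt hh₁ hh₂
  by_cases hh : h.val ≤ h₁.val ∨ h₂.val < h.val
  · have hm : h ∈ 𝒜 := by rw [h𝒜, mem_filter]; exact ⟨mem_univ _, hh⟩
    have hm' : h + 1 ∈ 𝒜 := by rw [h𝒜, mem_filter]; exact ⟨mem_univ _, hiff.1 hh⟩
    unfold dT
    rw [pswap_fst_of_mem _ hm, pswap_fst_of_mem _ hm', pswap_snd_of_mem _ hm,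
      pswap_snd_of_mem _ hm']
    ring
  · have hm : h ∉ 𝒜 := by rw [h𝒜, mem_filter]; exact fun h' => hh h'.2
    have hm' : h + 1 ∉ 𝒜 := by rw [h𝒜, mem_filter]; exact fun h' => hh (hiff.2 h'.2)
    unfold dT
    rw [pswap_fst_of_not_mem _ hm, pswap_fst_of_not_mem _ hm', pswap_snd_of_not_mem _ hm,
      pswap_snd_of_not_mem _ hm']

omit [MeasurableSpace E] [MeasurableSpace V] in
/-- The product of the two layer weights is invariant under every partial swap. [folklore] -/
theorem layerWeight_pswap (𝒜 : Finset (Fin (n + 1))) (β : ℂ)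
    (q : (Fin (n + 1) → E) × (Fin (n + 1) → E)) :
    D.layerWeight β (pswap 𝒜 q).1 * D.layerWeight β (pswap 𝒜 q).2 =
      D.layerWeight β q.1 * D.layerWeight β q.2 := by
  simp only [layerWeight, ← Complex.exp_add]
  congr 1
  rw [← mul_add, ← mul_add]
  congr 1
  push_cast
  rw [← sum_add_distrib, ← sum_add_distrib]
  refine sum_congr rfl fun h _ => ?_
  by_cases hh : h ∈ 𝒜
  · rw [pswap_fst_of_mem _ hh, pswap_snd_of_mem _ hh, add_comm]
  · rw [pswap_fst_of_not_mem _ hh, pswap_snd_of_not_mem _ hh]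

omit [MeasurableSpace E] in
/-- The replica observable `(x(η_0) − x(η'_0))(y(η_τ) − y(η'_τ))` is ODD under the partial swap of
an arc containing `0` and not `τ`. [folklore] -/
theorem replicaObs_pswap {𝒜 : Finset (Fin (n + 1))} (h0 : (0 : Fin (n + 1)) ∈ 𝒜) (hτ : τ ∉ 𝒜)
    (q : (Fin (n + 1) → E) × (Fin (n + 1) → E)) :
    ((((x ((pswap 𝒜 q).1 0) - x ((pswap 𝒜 q).2 0)) *
        (y ((pswap 𝒜 q).1 τ) - y ((pswap 𝒜 q).2 τ)) : ℝ) : ℂ)) =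
      -((((x (q.1 0) - x (q.2 0)) * (y (q.1 τ) - y (q.2 τ)) : ℝ) : ℂ)) := by
  rw [pswap_fst_of_mem _ h0, pswap_snd_of_mem _ h0, pswap_fst_of_not_mem _ hτ,
    pswap_snd_of_not_mem _ hτ]
  push_cast
  ring

omit [IsProbabilityMeasure μV] in
/-- **THE CUT CANCELLATION.**  If `S` misses a slab `h₁` with `h₁ < τ` and a slab `h₂` with
`τ ≤ h₂`, the replica term of `S` vanishes identically in `β`:
`∫∫ (x(η_0) − x(η'_0))(y(η_τ) − y(η'_τ)) Φ(η)Φ(η') ∏_{h∈S} T_h d(ν_E ⊗ ν_E) = 0`. [folklore] -/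
theorem integral_slabTerm_eq_zero_of_cut {S : Finset (Fin (n + 1))} {h₁ h₂ : Fin (n + 1)}
    (h₁S : h₁ ∉ S) (h₂S : h₂ ∉ S) (h₁τ : h₁.val < τ.val) (h₂τ : τ.val ≤ h₂.val) (β : ℂ) :
    ∫ q, (((x (q.1 0) - x (q.2 0)) * (y (q.1 τ) - y (q.2 τ)) : ℝ) : ℂ) *
        (D.layerWeight β q.1 * D.layerWeight β q.2) * ∏ h ∈ S, dT D μV c g β h q
        ∂((Measure.pi fun _ : Fin (n + 1) => μ).prod (Measure.pi fun _ : Fin (n + 1) => μ)) = 0 := by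
  set 𝒜 := univ.filter fun k : Fin (n + 1) => k.val ≤ h₁.val ∨ h₂.val < k.val with h𝒜
  have hlt : h₁.val < h₂.val := lt_of_lt_of_le h₁τ h₂τ
  have h0 : (0 : Fin (n + 1)) ∈ 𝒜 := by
    rw [h𝒜, mem_filter]; exact ⟨mem_univ _, Or.inl (by rw [Fin.val_zero]; exact Nat.zero_le _)⟩
  have hτ : τ ∉ 𝒜 := by
    rw [h𝒜, mem_filter]; rintro ⟨-, h | h⟩ <;> omega
  refine integral_eq_zero_of_pswap_odd μ 𝒜 fun q => ?_
  have hprod : ∏ h ∈ S, dT D μV c g β h (pswap 𝒜 q) = ∏ h ∈ S, dT D μV c g β h q :=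
    prod_congr rfl fun h hh => dT_pswap μV hlt (fun e => h₁S (e ▸ hh)) (fun e => h₂S (e ▸ hh)) β q
  rw [hprod, layerWeight_pswap, replicaObs_pswap h0 hτ]
  ring

end Cut

/-! ## 4. The trichotomy of subsets of slabs -/

/-- **Cut, short arc, or many slabs.**  If the long arc is longer than the short one (`2τ ≤ n`),
every set `S` of slabs either misses a slab on each arc, or is exactly the short arc `[0, τ)`, or
has at least `τ + 1` elements. [folklore] -/
theorem cut_or_eq_or_card {τ : Fin (n + 1)} (hτ2 : 2 * τ.val ≤ n) (S : Finset (Fin (n + 1))) :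
    (∃ h₁ h₂ : Fin (n + 1), h₁ ∉ S ∧ h₂ ∉ S ∧ h₁.val < τ.val ∧ τ.val ≤ h₂.val) ∨
      S = Iio τ ∨ τ.val + 1 ≤ S.card := by
  by_cases hA : ∃ h₁ : Fin (n + 1), h₁ ∉ S ∧ h₁.val < τ.val
  · by_cases hB : ∃ h₂ : Fin (n + 1), h₂ ∉ S ∧ τ.val ≤ h₂.val
    · obtain ⟨h₁, h₁S, h₁τ⟩ := hA
      obtain ⟨h₂, h₂S, h₂τ⟩ := hB
      exact Or.inl ⟨h₁, h₂, h₁S, h₂S, h₁τ, h₂τ⟩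
    · -- the long arc is inside `S`
      right; right
      push Not at hB
      have hsub : Ici τ ⊆ S := fun h hh => by
        by_contra hc
        exact absurd (hB h hc) (not_lt.2 (Fin.le_def.1 (mem_Ici.1 hh)))
      have hcard := card_le_card hsub
      rw [Fin.card_Ici] at hcard
      omega
  · -- the short arc is inside `S`
    push Not at hA
    have hsub : Iio τ ⊆ S := fun h hh => by
      by_contra hc
      exact absurd (hA h hc) (not_le.2 (Fin.lt_def.1 (mem_Iio.1 hh)))
    by_cases heq : S = Iio τ
    · exact Or.inr (Or.inl heq)
    · right; right
      have hss : Iio τ ⊂ S := lt_of_le_of_ne hsub (Ne.symm heq)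
      have hcard := card_lt_card hss
      rw [Fin.card_Iio] at hcard
      omega

end SlabChain

end Summit.Ventures.LatticeQCDFlow.Theory2

end
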